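import Mathlib.Topology.Algebra.Module.FiniteDimension
import Literature.IUT.LogVolume.TensorPacketHullVolume
import Literature.IUT.LogVolume.PadicLinearLatticeVolume
import Literature.IUT.LogVolume.LatticeAutomorphisms
import HarnessLib

/-!
# The log-shell lattice of a tensor packet and (Ind2) as lattice automorphisms preserving log-volume
# (Dupuy–Hilado §4 intro, §4.9; [IUTchIV] Prop. 1.2)

Dupuy–Hilado, arXiv:2004.13228 (pre-split text), read on the page (render chunks 13, 15–16). §4 intro: "At
the level of `𝕃_p^{(j)} := 𝔸^{⊗ j+1}_{V̲,p}` elements of Ind1 are just automorphisms of the finite dimensional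
`ℚ_p`-vector spaces `𝕃_p^{(j)}` induced by automorphisms of the `ℤ_p`-lattice `I^{⊗ j+1}_{V̲,p} ⊂ 𝕃_p^{(j)}`
… `I_{v⃗} = I_{v̲_0} ⊗ ⋯ ⊗ I_{v̲_j}` and for `v̲ ∈ V̲` we define `I_{v̲} = (1/2p_{v̲}) log(O^×_{v̲})`. The `I_{v̲}`
are Mochizuki's so-called log-shells. We will also see that the Ind2 indeterminacies also preserve this
lattice." §4.9: "They act through the group `Aut_{ℚ_p}(K_{v⃗} : I_{v⃗})` … `ℚ_p`-vector space
automorphisms which arise as `ℤ_p`-lattice isomorphisms … [footnote] Invertible linear maps on finite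
dimensional `ℚ_p`-vector spaces have determinant one. This means the distortion factor (the determinant) is
1 and the measure of sets are preserved under these maps." [IUTchIV] Prop. 1.2 (kurims p. 10): "`φ` … an
automorphism of the finite dimensional `ℚ_p`-vector space `log_p(R_I^×) ⊗ ℚ_p` that induces an automorphism
of the submodule `log_p(R_I^×)`" — abc-iut-S1's `IsLogPacketAut`.

WHAT THIS FILE DOES, for a packet `V = ⊗_{ℚ_p, i∈I} k_i` with its chosen decomposition `ψ : V ≃ Π_j L_j`
(`TensorPacketMeasure.lean`):

* `log_p(R_I^×) = ⊗ log_p(R_i^×)` (`logPacket`, abc-iut-S1) is a FULL `ℤ_p`-LATTICE: it contains a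
  nondegenerate multiple of `R_I` (`⊗α_i · R_I ⊆ log_p(R_I^×)`, `ord(α_i) = a_i`, [IUTchIV] Prop. 1.2 (i) as
  transported by abc-iut-S6) and is contained in a nondegenerate multiple of `(R_I)^∼` (`⊆ ⊗h_i · (R_I)^∼`,
  `ord(h_i) = −b_i`); `R_I` itself is the `ℤ_p`-lattice of the tensor basis of integral bases (abc-iut-S5),
  hence `ψ(R_I)` is OPEN in `⊕ L_j` (module topology = norm topology on a finite-dimensional `ℚ_p`-space); so
  `ψ(log_p(R_I^×))` is a COMPACT OPEN subgroup, `shellStructure : IntegralStructure (⊕ L_j)`, and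
  `log_p(R_I^×)`, and DH's log-shell `I_{v⃗} = (2p)^{−|I|} · log_p(R_I^×)` (`logShell`), are admissible;
* `indTwo := Aut_{ℚ_p}(V : log_p(R_I^×))` (gen-0's `latticeAut`; membership ⟺ S1's `IsLogPacketAut`) —
  DH's (Ind2) group at the summand (it is the same group for `I_{v⃗}`, a scalar multiple); and **the
  footnote PROVED**: every `φ ∈ indTwo` preserves `packetVol`, admissibility and `log μ̄` of EVERY subset
  (`packetVol_image_of_mem`, `packetLogμ_image_of_mem`) — by the lattice-automorphism invariance of Haar
  measure (`PadicModule.haar_image_linearEquiv_of_preserves`, seat abc-iut-c312-d1) applied on `⊕ L_j` to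
  `ψ ∘ φ ∘ ψ⁻¹`, which maps the compact open subgroup `ψ(log_p(R_I^×))` onto itself; and `φ(I_{v⃗}) = I_{v⃗}`.

[cite: DupuyHilado2025, §4 (intro), §4.9] [cite: Mochizuki2012, IUTchIV Prop. 1.2 p. 10]
Deliberately NOT here: (Ind1) (next file), Prop. 1.2 (ii)–(iv) themselves, anything about Cor. 3.12.
-/

noncomputable section

open MeasureTheory Set Metric
open scoped TensorProduct NormedField Pointwise ENNReal

namespace Literature.IUT.LogVolume

open Literature.NumberTheory.GaloisRepresentations.Ultrametric

variable (p : ℕ) [Fact p.Prime]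
variable {I : Type} [Fintype I] [DecidableEq I]
variable (k : I → Type) [∀ i, NontriviallyNormedField (k i)] [∀ i, NormedAlgebra ℚ_[p] (k i)]
  [∀ i, IsUltrametricDist (k i)] [∀ i, ProperSpace (k i)]

/-! ## `log_p(R_I^×)` is sandwiched between nondegenerate multiples of `R_I` and `(R_I)^∼` -/

section Sandwich

omit [Fintype I] [DecidableEq I]

/-- **`⊗α_i · R_I ⊆ log_p(R_I^×)`** for some family of NONZERO `α_i` (`ord(α_i) = a_i`; [IUTchIV] p. 11, third
inclusion, abc-iut-S6's transport of Prop. 1.2 (i)). [cite: Mochizuki2012, IUTchIV Prop. 1.2 (i) p. 10] -/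
theorem exists_purePacket_smul_integerPacket_subset_logPacket :
    ∃ α : Π i, k i, (∀ i, α i ≠ 0) ∧
      purePacket p k α • (integerPacket p k : Set (PacketAlgebra p k)) ⊆ logPacket p k := by
  have h := fun i => exists_norm_eq_rpow_neg_logRadiusA p (k i)
  choose α hα0 hα using h
  refine ⟨α, hα0, ?_⟩
  rintro _ ⟨r, hr, rfl⟩
  exact purePacket_mul_mem_logPacket p k (fun i => (hα i).le) hr

/-- **`log_p(R_I^×) ⊆ ⊗h_i · (R_I)^∼`** for some family of NONZERO `h_i` (`ord(h_i) = −b_i`; [IUTchIV] p. 11,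
fourth inclusion, and `R_I ⊆ (R_I)^∼`). [cite: Mochizuki2012, IUTchIV Prop. 1.2 (i) p. 10] -/
theorem exists_logPacket_subset_purePacket_smul_normalizedPacket :
    ∃ h : Π i, k i, (∀ i, h i ≠ 0) ∧
      (logPacket p k : Set (PacketAlgebra p k)) ⊆
        purePacket p k h • (normalizedPacket p k : Set (PacketAlgebra p k)) := by
  obtain ⟨h, hh⟩ := exists_realizesNegB p k
  refine ⟨h, ne_zero_of_realizesNegB p k hh, fun w hw => ?_⟩
  obtain ⟨y, hy, rfl⟩ := exists_mem_integerPacket_of_mem_logPacket p k hh hw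
  exact ⟨y, integerPacket_le_normalizedPacket p k hy, rfl⟩

end Sandwich

/-! ## `ψ(R_I)` is open; `ψ(log_p(R_I^×))` is a compact open subgroup of `⊕_j L_j` -/

section Lattice

variable [Nonempty I]

omit [DecidableEq I] [∀ i, IsUltrametricDist (k i)] [Nonempty I] in
/-- The sum `⊕_j L_j` carries the module topology (it is a finite-dimensional Hausdorff topological
`ℚ_p`-vector space over the complete field `ℚ_p`). [folklore] -/
private theorem isModuleTopology_dSum : IsModuleTopology ℚ_[p] (DSum p k) :=
  isModuleTopologyOfFiniteDimensional

/-- **`ψ(R_I)` is open in `⊕_j L_j`**: `R_I` is the `ℤ_p`-lattice of the tensor basis `B = ⊗_i b^{(i)}` of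
integral bases (abc-iut-S5), so `ψ(R_I)` is the lattice of the basis `ψ(B)`, open for the module topology.
[cite: Mochizuki2012, IUTchIV Prop. 1.1 p. 9] -/
theorem isOpen_image_integerPacket :
    IsOpen (dEquiv p k '' (integerPacket p k : Set (PacketAlgebra p k))) := by
  haveI := isModuleTopology_dSum p k
  obtain ⟨n, bZ, bQ, hb⟩ :
      ∃ (n : I → ℕ) (bZ : Π i, Module.Basis (Fin (n i)) ℤ_[p] (Valued.integer (k i)))
        (bQ : Π i, Module.Basis (Fin (n i)) ℚ_[p] (k i)), ∀ i j, bQ i j = (bZ i j : k i) := by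
    have hbases := fun i => exists_integralBasis (p := p) (k i)
    choose n bZ bQ hb using hbases
    exact ⟨n, bZ, bQ, hb⟩
  let B := (Basis.piTensorProduct bQ).map (dEquiv p k).toLinearEquiv
  have hEq : dEquiv p k '' (integerPacket p k : Set (PacketAlgebra p k)) =
      (PadicModule.basisLattice p B : Set (DSum p k)) := by
    ext w
    rw [SetLike.mem_coe, PadicModule.mem_basisLattice]
    constructor
    · rintro ⟨v, hv, rfl⟩ J
      have h := norm_repr_le_of_mem_integerPacket bZ bQ hb hv J
      simpa [B] using h
    · intro hw
      refine ⟨(dEquiv p k).symm w, ?_, (dEquiv p k).apply_symm_apply w⟩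
      refine mem_integerPacket_of_norm_repr_le bZ bQ hb fun J => ?_
      have h := hw J
      simpa [B] using h
  rw [hEq]
  exact PadicModule.isOpen_basisLattice p B

/-- `ψ(R_I)` has positive measure. [cite: Mochizuki2012, IUTchIV Prop. 1.1 p. 9] -/
theorem packetVol_integerPacket_pos : 0 < packetVol p k (integerPacket p k) :=
  (piUnitBallStructure (DFac p k)).haar_pos_of_isOpen (isOpen_image_integerPacket p k)
    ⟨dEquiv p k 0, 0, (integerPacket p k).zero_mem, rfl⟩

/-- `R_I` is admissible (`R_I ⊆ (R_I)^∼` bounds the measure above).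
[cite: Mochizuki2012, IUTchIV Prop. 1.1 p. 9] -/
theorem packetAdm_integerPacket : PacketAdm p k (integerPacket p k) :=
  ⟨packetVol_integerPacket_pos p k,
    lt_of_le_of_lt (measure_mono (image_mono (integerPacket_le_normalizedPacket p k)))
      (packetAdm_normalizedPacket p k).2⟩

/-- **`log_p(R_I^×)` is admissible**: it contains the admissible `⊗α·R_I` and is contained in the admissible
`⊗h·(R_I)^∼`. [cite: Mochizuki2012, IUTchIV Prop. 1.2 (i) p. 10] -/
theorem packetAdm_logPacket : PacketAdm p k (logPacket p k) := by
  obtain ⟨α, hα0, hα⟩ := exists_purePacket_smul_integerPacket_subset_logPacket p k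
  obtain ⟨h, hh0, hh⟩ := exists_logPacket_subset_purePacket_smul_normalizedPacket p k
  have h1 := packetAdm_smul p k _ (dEquiv_purePacket_ne_zero p k hα0) (packetAdm_integerPacket p k)
  have h2 := packetAdm_smul_normalizedPacket p k _ (dEquiv_purePacket_ne_zero p k hh0)
  exact ⟨lt_of_lt_of_le h1.1 (measure_mono (image_mono hα)),
    lt_of_le_of_lt (measure_mono (image_mono hh)) h2.2⟩

/-- `ψ(log_p(R_I^×))` as an additive subgroup of `⊕_j L_j`. [cite: Mochizuki2012, IUTchIV Prop. 1.2 p. 10] -/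
def imageLogPacket : AddSubgroup (DSum p k) :=
  (logPacket p k).map ((dEquiv p k : PacketAlgebra p k ≃ₐ[ℚ_[p]] DSum p k) : PacketAlgebra p k →+ DSum p k)

omit [DecidableEq I] [∀ i, IsUltrametricDist (k i)] [Nonempty I] in
/-- Its underlying set is `ψ(log_p(R_I^×))`. [cite: Mochizuki2012, IUTchIV Prop. 1.2 p. 10] -/
@[simp] theorem coe_imageLogPacket :
    (imageLogPacket p k : Set (DSum p k)) = dEquiv p k '' (logPacket p k : Set (PacketAlgebra p k)) :=
  AddSubgroup.coe_map _ _

/-- **`ψ(log_p(R_I^×))` is open** (a subgroup containing the open set `ψ(⊗α·R_I) = ψ(⊗α)·ψ(R_I)`).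
[cite: DupuyHilado2025, §4 (intro)] -/
theorem isOpen_imageLogPacket : IsOpen (imageLogPacket p k : Set (DSum p k)) := by
  obtain ⟨α, hα0, hα⟩ := exists_purePacket_smul_integerPacket_subset_logPacket p k
  -- the open subgroup `ψ(⊗α)·ψ(R_I)` sits inside
  let u := unitOfNe p k (dEquiv p k (purePacket p k α)) (dEquiv_purePacket_ne_zero p k hα0)
  have hopen : IsOpen (mulLeftEquiv p k u '' (dEquiv p k '' (integerPacket p k : Set (PacketAlgebra p k)))) :=
    (mulLeftEquiv p k u).toHomeomorph.isOpenMap _ (isOpen_image_integerPacket p k)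
  have hsub : mulLeftEquiv p k u '' (dEquiv p k '' (integerPacket p k : Set (PacketAlgebra p k))) ⊆
      (imageLogPacket p k : Set (DSum p k)) := by
    rw [coe_imageLogPacket]
    have h : mulLeftEquiv p k u '' (dEquiv p k '' (integerPacket p k : Set (PacketAlgebra p k))) =
        dEquiv p k '' (purePacket p k α • (integerPacket p k : Set (PacketAlgebra p k))) := by
      rw [image_smul_eq]; rfl
    rw [h]
    exact image_mono hα
  have h0 : (0 : DSum p k) ∈ mulLeftEquiv p k u '' (dEquiv p k '' (integerPacket p k : Set (PacketAlgebra p k))) :=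
    ⟨0, ⟨0, (integerPacket p k).zero_mem, map_zero _⟩, by simp⟩
  exact (imageLogPacket p k).isOpen_of_mem_nhds (mem_nhds_iff.mpr ⟨_, hsub, hopen, h0⟩)

/-- **`ψ(log_p(R_I^×))` is compact** (closed, being an open subgroup, and inside the polydisc `ψ(⊗h·(R_I)^∼)`).
[cite: DupuyHilado2025, §4 (intro)] -/
theorem isCompact_imageLogPacket : IsCompact (imageLogPacket p k : Set (DSum p k)) := by
  obtain ⟨h, hh0, hh⟩ := exists_logPacket_subset_purePacket_smul_normalizedPacket p k
  have hcpt : IsCompact (dEquiv p k '' (purePacket p k h • (normalizedPacket p k : Set (PacketAlgebra p k)))) := by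
    rw [image_smul_normalizedPacket_eq_hullSet p k (DFac p k) (dEquiv p k) _ (dEquiv_purePacket_ne_zero p k hh0)]
    exact isCompact_univ_pi fun j => isCompact_closedBall _ _
  have hclosed : IsClosed (imageLogPacket p k : Set (DSum p k)) :=
    (⟨imageLogPacket p k, isOpen_imageLogPacket p k⟩ : OpenAddSubgroup (DSum p k)).isClosed
  rw [coe_imageLogPacket] at hclosed ⊢
  exact hcpt.of_isClosed_subset hclosed (image_mono hh)

/-- **The log-shell integral structure of `⊕_j L_j`**: the compact open subgroup `ψ(log_p(R_I^×))`.
[cite: DupuyHilado2025, §4 (intro)] -/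
def shellStructure : IntegralStructure (DSum p k) :=
  ⟨⟨imageLogPacket p k, isOpen_imageLogPacket p k⟩, isCompact_imageLogPacket p k⟩

/-- Its underlying set. [cite: DupuyHilado2025, §4 (intro)] -/
@[simp] theorem coe_shellStructure :
    (shellStructure p k : Set (DSum p k)) = dEquiv p k '' (logPacket p k : Set (PacketAlgebra p k)) :=
  coe_imageLogPacket p k

end Lattice

/-! ## (Ind2): `Aut_{ℚ_p}(V : log_p(R_I^×))`, and the footnote "the measure of sets are preserved" -/

section IndTwo

omit [Fintype I] [DecidableEq I] [∀ i, IsUltrametricDist (k i)] [∀ i, ProperSpace (k i)]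

/-- **(Ind2) at the summand**: the `ℚ_p`-linear automorphisms of `V` mapping the lattice `log_p(R_I^×)` onto
itself (gen-0 `latticeAut`; = automorphisms preserving `I_{v⃗} = (2p)^{−|I|}·log_p(R_I^×)`, a scalar
multiple). [cite: DupuyHilado2025, §4.9] -/
def indTwo : Subgroup (PacketAlgebra p k ≃ₗ[ℚ_[p]] PacketAlgebra p k) :=
  latticeAut ℚ_[p] (logPacket p k).toIntSubmodule

/-- Membership: `φ ∈ indTwo ↔ ∀ x, (φ x ∈ log_p(R_I^×) ↔ x ∈ log_p(R_I^×))`. [cite: DupuyHilado2025, §4.9] -/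
theorem mem_indTwo_iff (φ : PacketAlgebra p k ≃ₗ[ℚ_[p]] PacketAlgebra p k) :
    φ ∈ indTwo p k ↔ ∀ x, φ x ∈ logPacket p k ↔ x ∈ logPacket p k := Iff.rfl

/-- Members of (Ind2) map `log_p(R_I^×)` ONTO itself ("induces an automorphism of the submodule", S1's
`IsLogPacketAut`). [cite: Mochizuki2012, IUTchIV Prop. 1.2 p. 10] -/
theorem image_logPacket_of_mem {φ : PacketAlgebra p k ≃ₗ[ℚ_[p]] PacketAlgebra p k} (hφ : φ ∈ indTwo p k) :
    φ '' (logPacket p k : Set (PacketAlgebra p k)) = logPacket p k :=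
  latticeAut.image_eq hφ

/-- … i.e. they are exactly S1's log-packet automorphisms. [cite: Mochizuki2012, IUTchIV Prop. 1.2 p. 10] -/
theorem isLogPacketAut_of_mem {φ : PacketAlgebra p k ≃ₗ[ℚ_[p]] PacketAlgebra p k} (hφ : φ ∈ indTwo p k) :
    IsLogPacketAut p k φ :=
  image_logPacket_of_mem p k hφ

/-- Conversely, `φ(log_p(R_I^×)) = log_p(R_I^×)` puts `φ` in (Ind2). [cite: DupuyHilado2025, §4.9] -/
theorem mem_indTwo_of_image_eq {φ : PacketAlgebra p k ≃ₗ[ℚ_[p]] PacketAlgebra p k}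
    (h : φ '' (logPacket p k : Set (PacketAlgebra p k)) = logPacket p k) : φ ∈ indTwo p k := by
  refine mem_latticeAut_of_mapsTo φ (fun x hx => ?_) (fun x hx => ?_)
  · have : φ x ∈ φ '' (logPacket p k : Set (PacketAlgebra p k)) := ⟨x, hx, rfl⟩
    rw [h] at this
    exact this
  · have hx' : x ∈ φ '' (logPacket p k : Set (PacketAlgebra p k)) := by rw [h]; exact hx
    obtain ⟨y, hy, hyx⟩ := hx'
    have : φ.symm x = y := by rw [← hyx, LinearEquiv.symm_apply_apply]
    rw [this]
    exact hy

/-- A linear `φ` commutes with scalars on subsets: `φ(c·A) = c·φ(A)`. [cite: DupuyHilado2025, §4.9] -/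
theorem image_const_smul (φ : PacketAlgebra p k ≃ₗ[ℚ_[p]] PacketAlgebra p k) (c : ℚ_[p])
    (A : Set (PacketAlgebra p k)) : φ '' (c • A) = c • φ '' A := by
  rw [← image_smul, ← image_smul, image_image, image_image]
  exact image_congr fun a _ => by simp

/-- (Ind2) acts on `V`; `g • A = g(A)` for subsets. [cite: DupuyHilado2025, §4.9] -/
theorem indTwo_smul_set (g : indTwo p k) (A : Set (PacketAlgebra p k)) :
    g • A = (g : PacketAlgebra p k ≃ₗ[ℚ_[p]] PacketAlgebra p k) '' A := by
  rw [← image_smul]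
  rfl

end IndTwo

section IndTwoVolume

variable [Nonempty I]

omit [DecidableEq I] [∀ i, IsUltrametricDist (k i)] [Nonempty I] in
/-- Conjugating `φ` by `ψ`: `(ψ ∘ φ ∘ ψ⁻¹)(ψ(A)) = ψ(φ(A))`. [folklore] -/
private theorem image_conj (φ : PacketAlgebra p k ≃ₗ[ℚ_[p]] PacketAlgebra p k) (A : Set (PacketAlgebra p k)) :
    ((dEquiv p k).toLinearEquiv.symm.trans (φ.trans (dEquiv p k).toLinearEquiv)) '' (dEquiv p k '' A) =
      dEquiv p k '' (φ '' A) := by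
  rw [image_image, image_image]
  refine image_congr fun a _ => ?_
  simp

/-- **"The measure of sets are preserved under these maps"** (Dupuy–Hilado §4.9 footnote), PROVED for the
real packet: every `φ ∈ Aut_{ℚ_p}(V : log_p(R_I^×))` satisfies `μ(φ(A)) = μ(A)` for EVERY `A ⊆ V` — the
conjugate `ψ ∘ φ ∘ ψ⁻¹` is a `ℚ_p`-linear automorphism of `⊕_j L_j` mapping the compact open subgroup
`ψ(log_p(R_I^×))` onto itself, so it preserves every normalised Haar measure (seat abc-iut-c312-d1's
`PadicModule.haar_image_linearEquiv_of_preserves`). [cite: DupuyHilado2025, §4.9] -/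
theorem packetVol_image_of_mem {φ : PacketAlgebra p k ≃ₗ[ℚ_[p]] PacketAlgebra p k} (hφ : φ ∈ indTwo p k)
    (A : Set (PacketAlgebra p k)) : packetVol p k (φ '' A) = packetVol p k A := by
  haveI : IsModuleTopology ℚ_[p] (DSum p k) := isModuleTopologyOfFiniteDimensional
  let Φ := (dEquiv p k).toLinearEquiv.symm.trans (φ.trans (dEquiv p k).toLinearEquiv)
  have hΦ : Φ '' (shellStructure p k : Set (DSum p k)) = (shellStructure p k : Set (DSum p k)) := by
    rw [coe_shellStructure, image_conj, image_logPacket_of_mem p k hφ]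
  unfold packetVol
  rw [← image_conj]
  exact PadicModule.haar_image_linearEquiv_of_preserves p _ Φ (shellStructure p k) hΦ _

/-- (Ind2) preserves admissibility. [cite: DupuyHilado2025, §4.9] -/
theorem packetAdm_image_of_mem {φ : PacketAlgebra p k ≃ₗ[ℚ_[p]] PacketAlgebra p k} (hφ : φ ∈ indTwo p k)
    {A : Set (PacketAlgebra p k)} (hA : PacketAdm p k A) : PacketAdm p k (φ '' A) := by
  unfold PacketAdm
  rw [packetVol_image_of_mem p k hφ]
  exact hA

/-- **(Ind2) preserves `log μ̄`** of every subset. [cite: DupuyHilado2025, §4.9] -/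
theorem packetLogμ_image_of_mem {φ : PacketAlgebra p k ≃ₗ[ℚ_[p]] PacketAlgebra p k} (hφ : φ ∈ indTwo p k)
    (A : Set (PacketAlgebra p k)) : packetLogμ p k (φ '' A) = packetLogμ p k A := by
  have h := packetVol_image_of_mem p k hφ A
  unfold packetVol at h
  simp only [packetLogμ_eq, IntegralStructure.normalizedLogVolume, IntegralStructure.logVolume, h]

/-- (Ind2), group-action form: `g·A` is admissible iff … (for `g ∈ indTwo`). [cite: DupuyHilado2025, §4.9] -/
theorem packetAdm_indTwo_smul (g : indTwo p k) {A : Set (PacketAlgebra p k)} (hA : PacketAdm p k A) :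
    PacketAdm p k (g • A) := by
  rw [indTwo_smul_set]
  exact packetAdm_image_of_mem p k g.2 hA

/-- (Ind2), group-action form: `log μ̄(g·A) = log μ̄(A)`. [cite: DupuyHilado2025, §4.9] -/
theorem packetLogμ_indTwo_smul (g : indTwo p k) (A : Set (PacketAlgebra p k)) :
    packetLogμ p k (g • A) = packetLogμ p k A := by
  rw [indTwo_smul_set]
  exact packetLogμ_image_of_mem p k g.2 A

end IndTwoVolume

/-! ## Dupuy–Hilado's log-shell `I_{v⃗} = ⊗_i (1/2p)·log(O^×_i) = (2p)^{−|I|}·log_p(R_I^×)` -/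

section Shell

/-- The scalar `(2p)^{−|I|}` (one factor `1/2p_{v̲}` per tensor slot). [cite: DupuyHilado2025, §4 (intro)] -/
def shellScalar : ℚ_[p] := ((2 * p : ℚ_[p]) ^ Fintype.card I)⁻¹

omit [DecidableEq I] in
/-- `(2p)^{−|I|} ≠ 0`. [cite: DupuyHilado2025, §4 (intro)] -/
theorem shellScalar_ne_zero : shellScalar p (I := I) ≠ 0 := by
  have hp : (p : ℚ_[p]) ≠ 0 := by exact_mod_cast (Fact.out : p.Prime).ne_zero
  have h2 : (2 : ℚ_[p]) ≠ 0 := two_ne_zero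
  exact inv_ne_zero (pow_ne_zero _ (mul_ne_zero h2 hp))

/-- **The log-shell** `I_{v⃗} := (2p)^{−|I|} · log_p(R_I^×)` ("`I_{v⃗} = I_{v̲_0} ⊗ ⋯ ⊗ I_{v̲_j}`,
`I_{v̲} = (1/2p_{v̲}) log(O^×_{v̲})`", the scalars pulled out of the `|I|` slots).
[cite: DupuyHilado2025, §4 (intro)] -/
def logShell : Set (PacketAlgebra p k) := shellScalar p (I := I) • (logPacket p k : Set (PacketAlgebra p k))

variable [Nonempty I]

/-- The log-shell is admissible. [cite: DupuyHilado2025, §4 (intro)] -/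
theorem packetAdm_logShell : PacketAdm p k (logShell p k) :=
  packetAdm_const_smul p k (shellScalar_ne_zero p) (packetAdm_logPacket p k)

omit [DecidableEq I] [∀ i, IsUltrametricDist (k i)] [∀ i, ProperSpace (k i)] [Nonempty I] in
/-- **"the Ind2 indeterminacies also preserve this lattice"**: `φ(I_{v⃗}) = I_{v⃗}` for `φ ∈ indTwo`.
[cite: DupuyHilado2025, §4 (intro), §4.9] -/
theorem image_logShell_of_mem {φ : PacketAlgebra p k ≃ₗ[ℚ_[p]] PacketAlgebra p k}
    (hφ : φ ∈ indTwo p k) : φ '' logShell p k = logShell p k := by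
  rw [logShell, image_const_smul, image_logPacket_of_mem p k hφ]

omit [DecidableEq I] [∀ i, IsUltrametricDist (k i)] [∀ i, ProperSpace (k i)] [Nonempty I] in
/-- Group-action form: `g • I_{v⃗} = I_{v⃗}`. [cite: DupuyHilado2025, §4 (intro), §4.9] -/
theorem indTwo_smul_logShell (g : indTwo p k) : g • logShell p k = logShell p k := by
  rw [indTwo_smul_set]
  exact image_logShell_of_mem p k g.2

end Shell

end Literature.IUT.LogVolume

end
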